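import Summits.QuantumFields.YangMills.Theorems.UnitScaleTiltProp7GreenOneBlockFamilyPackage
import Summits.QuantumFields.YangMills.Theorems.UnitScaleTiltProp7OneFormGreenBlockDivergenceFamilyAllMembers
import Summits.QuantumFields.YangMills.Theorems.UnitScaleTiltProp7GaugeProjectorBlockPackageC2AllMembers
import Summits.QuantumFields.YangMills.Theorems.UnitScaleTiltProp7TJSlotCoerciveClosedAllMembers
import HarnessLib

/-!
# (R-EDITION, ROOM-FREE: ✓p777462 `…GreenOneBlockFamilyPackage` §3 re-run over the `_allMembers` suppliers — (Db) ✓p776692, (c2b) ✓p776021, T3-R, T1-R B ✓p777505, K6-h133-R;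
# the no-wrap ROOM antecedent is GONE from the statement; §1∕§2 are IMPORTED from ✓p777462; nothing else changed.)
# Route `UnitScaleTilt`, crux K1 «MinimiserStabilityRegPr» (stmt-QuantumFields-19200), EX rows `norm_G`∕`norm_H₁` (J-slot `Δ₁ᴾ`), family level — (GJ-PKG):
# **THE `hGblk`(Δ₁) AND `hΔb`(Δ₁) ∃-PACKAGE** — E2 ✓`hGblk_one_of_blockLetters` and E4 ✓`hDelta_one_of_blockLetters` AT EVERY MEMBER, their SEVEN block letters, the two positivity
# classes and the window DISCHARGED by landed L-only families: (Gb) ✓`blockSup_GT_DeltaEtaSlot_family`, (Db) ✓`divergence_GT_DeltaEtaSlot_family`, (c1b)(c3b) ✓`hc1b_hc3b_family`,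
# (c2b) ✓`hc2b_family`, (Tb) T1 ✓`tjValueRows_family_of_h133` ∘ ✓`h133_family_exists` (via T3 ✓`tjValueRows_exists`), (TDb) T1 ✓`tjDivRows_family_of_h133_hqG` (the gauge-spike
# Hessian row `hqG` DISPLAYED — px19's (q-gauge) programme), `PosOnto`(Δ^η) ✓`hco_DeltaEtaSlot_exists`, `PosOnto`(Δ₁ᴾ) T3 ✓`hco_DeltaOnePJ_exists`

Cell `ym3-torus` (HUMAN RULING D-0037; rung R3 = SU(2) YM₃ on T³ — NOT d = 4, NOT infinite volume, NOT a mass gap, NOT Clay).  Width seat `ym3-torus-px12` (gen 18); px16 g14's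
13:44Z «GJ-PKG» LOCATE is the cut, px16's GΠ-PKG ✓p775408 the token pattern.  THEOREMS ONLY (0 `def`, 0 `sorry`); `--supports stmt-QuantumFields-19200 --as helper`; count-neutral.

WHAT.  ★★★ `hGblk_one_family_exists` — for positive L-only weights `c₀ cB`, a coupling window `0 < a₀ ≤ a₁`, and px19's `hqG` family (letters `αq qG`; DISPLAYED), THERE ARE L-only
`αP CP KP δP : ℕ → ℝ` (cap with the three windows of record and `≤ 1`, constants `≥ 0`, rate `> 0`) such that for every `L > 1`, member `i`, background `U₀` with `RegPr ρ U₀`, `ρ ≤ αP L`,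
under `Lift`, ROOM and the coupling window: E2's two conclusions (the block-supported decayed sup row of `G₁ = GT … a (DeltaOneP … a (TJSlotP … a)) U₀` and its `D*`-twin, constant
`CP L`, rate `δP L`) AND, third, E4's cone letter `G₁ − G₀` with constant `α′·KP L` for EVERY radius `0 < α′ ≤ αP L` with `RegPr α′ U₀` — LINEAR IN THE RADIUS (the J-term constants
`CT = α′·MT·e^{δ₁}`, `CTD = α′·MD·e^{δ₁}` from T1 are, and E4's `hreg` is taken at `α′`), which is what the slot-generic cone ✓`kinvRow_slot_family_of_cone` needs at `Δx := Δ₁ᴾ` (K6-Δ₁).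
PROOF.  §2 = E2∕E4 at the member with radius-linear T-letters (window §1 `hwinJ_E2shape`, E4's constant ≤ `α′·KP` by §1 `coneJ_E4shape`); §3 = nine `obtain`s, common rate
`δ₁ L := min` of the four G-letter rates (✓`blockLetter_mono_rate`), T letters TAKEN at rate `δ₁`, `ν = δ = δ₁∕2`, cap `αP ≤ 1∕(2W+2)`.
HONEST SCOPE.  An `∃`-package over landed `∃`-packages and E2∕E4's member theorems; CONDITIONAL on the displayed `hqG` family ONLY; nothing of `hqG`, `hKinv`(Δ₁), `norm_H₁`, EX or the
crux is proved; no summit is proved by a helper.  Credit: E1∕E2 ★p1 g27, E4 px10 g14, families px16∕px21∕px5, (γ) ★p1, the cut px16 g14.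

References: T. Bałaban, CMP **99** (1985) 389–434 [Balaban1985BackgroundPropagators] (Thm 3.3 (3.46)–(3.49) pp.398–399, (3.122) p.420, (3.127)–(3.131) pp.421–422, Thm 3.12 p.423);
CMP **102** (1985) 277–309 [Balaban1985Variational] (Thm 1 p.279).
-/

set_option autoImplicit false

noncomputable section

open scoped Matrix.Norms.L2Operator BigOperators InnerProductSpace ComplexConjugate

namespace Summit.QuantumFields.YangMills.Theorems.Prop7GreenOneBlockFamilyPackageAllMembers

open Literature.MathematicalPhysics.QuantumFieldTheory.Balaban1983to89
open Literature.MathematicalPhysics.QuantumFieldTheory.Balaban1983to89.T3ContinuumYM3Torus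
open Literature.MathematicalPhysics.QuantumFieldTheory.Balaban1983to89.T3Thm1Carrier (Idx)
open Literature.MathematicalPhysics.QuantumFieldTheory.Balaban1983to89.T3PrintedRegularMinimiser (RegPr)
open Literature.MathematicalPhysics.QuantumFieldTheory.Balaban1983to89.T3PrintedMinimiserExistence (regPr_mono)
open B15DeterminingSets (embIter)
open T3SectALandauChart (bgUnits)
open B11Eq103H1Complex (BondL2K)
open B5Eq118OneStroke (iterBlockOf)
open Summit.QuantumFields.YangMills.Theorems.Prop8Chart (emlIterU)
open Summit.QuantumFields.YangMills.Theorems.Prop7SectET3Transport (periodsT3)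
open Summit.QuantumFields.YangMills.Theorems.Prop7SectET3HilbertLetters (W₂ toL2 toL2S DL2 DstarL2)
open Summit.QuantumFields.YangMills.Theorems.Prop7SectET3WilsonHessian (DeltaEtaSlot)
open Summit.QuantumFields.YangMills.Theorems.Prop7SectET3GaugeProjector (RS)
open Summit.QuantumFields.YangMills.Theorems.Prop7SectET3CurvedPropagators (laplaceA GT PosOnto)
open Summit.QuantumFields.YangMills.Theorems.Prop7SectET3DeltaPiPInv (GprimeP)
open Summit.QuantumFields.YangMills.Theorems.Prop7SectET3DeltaOne (avgHess)
open Summit.QuantumFields.YangMills.Theorems.Prop7SectET3DeltaOnePInv (DeltaOneP TJSlotP)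
open Summit.QuantumFields.YangMills.Theorems.Prop7OneFormCoerciveHolds (hco_DeltaEtaSlot_exists posOnto_of_coercive)
open Summit.QuantumFields.YangMills.Theorems.Prop7OneFormGreenBlockSupFamily (blockSup_GT_DeltaEtaSlot_family)
open Summit.QuantumFields.YangMills.Theorems.Prop7OneFormGreenBlockDivergenceFamilyAllMembers (divergence_GT_DeltaEtaSlot_family_allMembers)
open Summit.QuantumFields.YangMills.Theorems.Prop7GaugeProjectorBlockPackageFamily (hc1b_hc3b_family)
open Summit.QuantumFields.YangMills.Theorems.Prop7GaugeProjectorBlockPackageC2AllMembers (hc2b_family_allMembers)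
open Summit.QuantumFields.YangMills.Theorems.Prop7Kernel133OfPiBlockLetters (blockLetter_mono_rate)
open Summit.QuantumFields.YangMills.Theorems.Prop7GreenOneBlockLettersEdition (hGblk_one_of_blockLetters)
open Summit.QuantumFields.YangMills.Theorems.Prop7GreenOneMinusEtaBlockDecay (hDelta_one_of_blockLetters)
open Summit.QuantumFields.YangMills.Theorems.Prop7TJRowsFamilyOfH133AllMembers (tjDivRows_family_of_h133_hqG_allMembers)
open Summit.QuantumFields.YangMills.Theorems.Prop7H133FamilyPackageAllMembers (h133_family_exists_allMembers)
open Summit.QuantumFields.YangMills.Theorems.Prop7TJSlotCoerciveClosedAllMembers (tjValueRows_exists_allMembers hco_DeltaOnePJ_exists_allMembers)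
open Summit.QuantumFields.YangMills.Theorems.Prop7GreenOneBlockFamilyPackage (hwinJ_E2shape coneJ_E4shape hGblk_one_member hDelta_one_member)

/-! ## §3 ★★★ The `hGblk`(Δ₁) + `hΔb`(Δ₁) family, ∃-packaged -/
set_option maxHeartbeats 400000 in
-- HEARTBEAT BUDGET (README rule, disclosed): nine `obtain`s + six `blockLetter_mono_rate` readers + two §2 instantiations in ONE decl — MEASURED: fails at 100 000, passes at the
-- 200 000 default (GΠ-PKG's class); budgeted ×2 against the CI cliff.  §1∕§2 pass at 100 000.
/-- ★★★ **THE `hGblk`(Δ₁) FAMILY AND THE CONE LETTER `G₁ − G₀` FOR ALL MEMBERS, L-ONLY CONSTANTS** (cap `αP`, constants `CP KP`, rate `δP`; thread `Lift ∧ ROOM ∧` coupling window;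
the gauge-spike Hessian row `hqG` DISPLAYED): conj 1∕2 = E2's two conclusions at `TJ := TJSlotP … a`; conj 3 = E4's `hΔb` text with constant `α′·KP L` for every radius `0 < α′ ≤ αP L`
with `RegPr α′ U₀`. [cite: Balaban1985BackgroundPropagators, Thm 3.3 (3.46)–(3.49) pp.398–399, (3.122) p.420, (3.127)–(3.131) pp.421–422, Thm 3.12 p.423; Balaban1985Variational, Thm 1 p.279] -/
theorem hGblk_one_family_exists_allMembers [hFL : ∀ F : T3Family, Fact (0 < (F.L : ℝ))] [hFη : ∀ (F : T3Family) (k : ℕ), Fact (0 < ((F.L : ℝ)⁻¹) ^ k)]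
    (c₀ cB : ℕ → ℝ) [hc₀ : ∀ L : ℕ, Fact (0 < c₀ L)] [hcB : ∀ L : ℕ, Fact (0 < cB L)] {a₀ a₁ : ℝ} (ha₀ : 0 < a₀) (ha₀₁ : a₀ ≤ a₁)
    (αq qG : ℕ → ℝ) (hαq : ∀ L : ℕ, 1 < L → 0 < αq L) (hqG : ∀ L : ℕ, 1 < L → 0 ≤ qG L)
    (hqGrow : ∀ (L : ℕ), 1 < L → ∀ (i : Idx L) (U₀ : GaugeField (i.1.1.P i.1.2.2) 0 (Matrix.specialUnitaryGroup (Fin 2) ℂ)), RegPr i.1.1 i.1.2.1 i.1.2.2 (αq L) U₀ →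
      ∀ (X' : PBond (i.1.1.P i.1.2.2) 0 → Matrix (Fin 2) (Fin 2) ℂ) (s : ℝ) (x : Site (i.1.1.P i.1.2.2) 0) (A : Matrix (Fin 2) (Fin 2) ℂ), (∀ b, ‖X' b‖ ≤ s) →
        ∑ y : PBond (i.1.1.P i.1.2.1) 0, ‖avgHess i.1.1 i.1.2.1 i.1.2.2 i.2.2.le U₀ X'
            ((toL2 i.1.1 i.1.2.2 (c₀ L)).symm (DL2 i.1.1 i.1.2.1 i.1.2.2 (c₀ L) U₀ (toL2S i.1.1 i.1.2.2 (c₀ L) (Pi.single x A)))) y‖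
          ≤ qG L * ((L : ℝ) ^ (i.1.2.2 - i.1.2.1))⁻¹ * s * ‖A‖) :
    ∃ (αP CP KP δP : ℕ → ℝ),
      (∀ L : ℕ, 1 < L → 0 < αP L) ∧ (∀ L : ℕ, 1 < L → 10 ^ 12 * (L : ℝ) ^ 3 * αP L ≤ 1) ∧ (∀ L : ℕ, 1 < L → 10 ^ 10 * (L : ℝ) ^ 6 * αP L ≤ 1) ∧
      (∀ L : ℕ, 1 < L → 13 * 10 ^ 14 * (L : ℝ) ^ 3 * αP L ≤ 1) ∧ (∀ L : ℕ, 1 < L → αP L ≤ 1) ∧ (∀ L : ℕ, 1 < L → 0 ≤ CP L) ∧ (∀ L : ℕ, 1 < L → 0 ≤ KP L) ∧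
      (∀ L : ℕ, 1 < L → 0 < δP L) ∧
    ∀ (L : ℕ), 1 < L → ∀ (i : Idx L) (U₀ : GaugeField (i.1.1.P i.1.2.2) 0 (Matrix.specialUnitaryGroup (Fin 2) ℂ)), ∀ ρ : ℝ, RegPr i.1.1 i.1.2.1 i.1.2.2 ρ U₀ → ρ ≤ αP L →
        (∀ cf : Site (i.1.1.P i.1.2.2) (i.1.2.2 - i.1.2.1) → Matrix (Fin 2) (Fin 2) ℂ,
        (∀ e' : PBond (i.1.1.P i.1.2.2) (i.1.2.2 - i.1.2.1), cf e'.src = ((emlIterU (i.1.2.2 - i.1.2.1) (bgUnits i.1.1 i.1.2.2 U₀) e' : (Matrix (Fin 2) (Fin 2) ℂ)ˣ) : Matrix (Fin 2) (Fin 2) ℂ) * cf e'.tgt *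
        (((emlIterU (i.1.2.2 - i.1.2.1) (bgUnits i.1.1 i.1.2.2 U₀) e')⁻¹ : (Matrix (Fin 2) (Fin 2) ℂ)ˣ) : Matrix (Fin 2) (Fin 2) ℂ)) →
        ∃ l₀ : Site (i.1.1.P i.1.2.2) 0 → Matrix (Fin 2) (Fin 2) ℂ,
        (∀ b' : PBond (i.1.1.P i.1.2.2) 0, l₀ b'.src = ((bgUnits i.1.1 i.1.2.2 U₀ b' : (Matrix (Fin 2) (Fin 2) ℂ)ˣ) : Matrix (Fin 2) (Fin 2) ℂ) * l₀ b'.tgt * (((bgUnits i.1.1 i.1.2.2 U₀ b')⁻¹ : (Matrix (Fin 2) (Fin 2) ℂ)ˣ) : Matrix (Fin 2) (Fin 2) ℂ)) ∧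
        ∀ y : Site (i.1.1.P i.1.2.2) (i.1.2.2 - i.1.2.1), l₀ (embIter (i.1.2.2 - i.1.2.1) y) = cf y) →
      ∀ a : ℝ, a₀ * (c₀ L / cB L) * ((i.1.1.L : ℝ) ^ (i.1.2.2 - i.1.2.1)) ^ 3 ≤ a → a ≤ a₁ * (c₀ L / cB L) * ((i.1.1.L : ℝ) ^ (i.1.2.2 - i.1.2.1)) ^ 3 →
      (∀ (X : PBond (i.1.1.P i.1.2.2) 0 → Matrix (Fin 2) (Fin 2) ℂ) (z : Site (i.1.1.P i.1.2.2) (i.1.2.2 - i.1.2.1)),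
        (∀ b, X b ≠ 0 → iterBlockOf (i.1.2.2 - i.1.2.1) b.src = z) → ∀ s : ℝ, 0 ≤ s → (∀ b, ‖X b‖ ≤ s) →
          ∀ bd : PBond (i.1.1.P i.1.2.2) 0,
            ‖(toL2 i.1.1 i.1.2.2 (c₀ L)).symm (GT i.1.1 i.1.2.1 i.1.2.2 i.2.2.le (c₀ L) (cB L) a (DeltaOneP i.1.1 i.1.2.1 i.1.2.2 i.2.2.le (c₀ L) (cB L) a (TJSlotP i.1.1 i.1.2.1 i.1.2.2 i.2.2.le (c₀ L) (cB L) a)) U₀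
                (toL2 i.1.1 i.1.2.2 (c₀ L) X)) bd‖
              ≤ s * CP L * Real.exp (-(δP L * (Site.tdist (P := i.1.1.P i.1.2.2) (iterBlockOf (i.1.2.2 - i.1.2.1) bd.src) z : ℝ)))) ∧
      (∀ (X : PBond (i.1.1.P i.1.2.2) 0 → Matrix (Fin 2) (Fin 2) ℂ) (z : Site (i.1.1.P i.1.2.2) (i.1.2.2 - i.1.2.1)),
        (∀ b, X b ≠ 0 → iterBlockOf (i.1.2.2 - i.1.2.1) b.src = z) → ∀ s : ℝ, 0 ≤ s → (∀ b, ‖X b‖ ≤ s) →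
          ∀ x : Site (i.1.1.P i.1.2.2) 0,
            ‖(toL2S i.1.1 i.1.2.2 (c₀ L)).symm (DstarL2 i.1.1 i.1.2.1 i.1.2.2 (c₀ L) U₀ (GT i.1.1 i.1.2.1 i.1.2.2 i.2.2.le (c₀ L) (cB L) a
                (DeltaOneP i.1.1 i.1.2.1 i.1.2.2 i.2.2.le (c₀ L) (cB L) a (TJSlotP i.1.1 i.1.2.1 i.1.2.2 i.2.2.le (c₀ L) (cB L) a)) U₀ (toL2 i.1.1 i.1.2.2 (c₀ L) X))) x‖
              ≤ s * CP L * Real.exp (-(δP L * (Site.tdist (P := i.1.1.P i.1.2.2) (iterBlockOf (i.1.2.2 - i.1.2.1) x) z : ℝ)))) ∧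
      (∀ α' : ℝ, 0 < α' → α' ≤ αP L → RegPr i.1.1 i.1.2.1 i.1.2.2 α' U₀ →
        ∀ (X : PBond (i.1.1.P i.1.2.2) 0 → Matrix (Fin 2) (Fin 2) ℂ) (z : Site (i.1.1.P i.1.2.2) (i.1.2.2 - i.1.2.1)),
        (∀ b, X b ≠ 0 → iterBlockOf (i.1.2.2 - i.1.2.1) b.src = z) → ∀ s : ℝ, 0 ≤ s → (∀ b, ‖X b‖ ≤ s) →
          ∀ bd : PBond (i.1.1.P i.1.2.2) 0,
            ‖(toL2 i.1.1 i.1.2.2 (c₀ L)).symm ((GT i.1.1 i.1.2.1 i.1.2.2 i.2.2.le (c₀ L) (cB L) a (DeltaOneP i.1.1 i.1.2.1 i.1.2.2 i.2.2.le (c₀ L) (cB L) a (TJSlotP i.1.1 i.1.2.1 i.1.2.2 i.2.2.le (c₀ L) (cB L) a)) U₀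
                - GT i.1.1 i.1.2.1 i.1.2.2 i.2.2.le (c₀ L) (cB L) a (DeltaEtaSlot i.1.1 i.1.2.1 i.1.2.2 (c₀ L)) U₀) (toL2 i.1.1 i.1.2.2 (c₀ L) X)) bd‖
              ≤ s * (α' * KP L) * Real.exp (-(δP L * (Site.tdist (P := i.1.1.P i.1.2.2) (iterBlockOf (i.1.2.2 - i.1.2.1) bd.src) z : ℝ)))) := by
  obtain ⟨αG, BV, δG, hαG0, hWG1, hWG2, hWG3, hBV0, hδG0, hGb⟩ := blockSup_GT_DeltaEtaSlot_family c₀ cB ha₀ ha₀₁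
  obtain ⟨αD, BD, δD, hαD0, hWD1, hWD2, hWD3, hBD0, hδD0, hDb⟩ := divergence_GT_DeltaEtaSlot_family_allMembers c₀ cB ha₀ ha₀₁
  obtain ⟨αC, C₁, δC, hαC, hC₁0, hδC0, hC13⟩ := hc1b_hc3b_family (am := 1) one_pos c₀ cB
  obtain ⟨αC2, C₂, δC2, hαC2, hC₂0, hδC20, hC2⟩ := hc2b_family_allMembers (am := 1) one_pos c₀ cB
  obtain ⟨αη, γη, hαη0, hWη1, hWη3, hγη, hcoη⟩ := hco_DeltaEtaSlot_exists c₀ cB ha₀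
  obtain ⟨αc, γc, hαc0, hWc1, hWc3, hγc, hco1⟩ := hco_DeltaOnePJ_exists_allMembers c₀ cB ha₀ ha₀₁
  obtain ⟨αT, MT, hαT0, hWT1, hWT2, hWT3, hWT5, hαT1, hMT0, hTv⟩ := tjValueRows_exists_allMembers c₀ cB ha₀ ha₀₁
  obtain ⟨αH, CH, δH, hαH, hWH12, hWH10, hWH13, -, hCH, hδH, h133⟩ := h133_family_exists_allMembers c₀ cB ha₀ ha₀₁
  obtain ⟨αDv, MD, hαDv0, hWDv1, hWDv2, hWDv3, hDvH, hDvq, hαDv1, hMD0, hTd⟩ :=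
    tjDivRows_family_of_h133_hqG_allMembers c₀ cB αH CH δH hαH hWH12 hWH10 hWH13 hCH hδH h133 αq qG hαq hqG hqGrow
  set δ₁ : ℕ → ℝ := fun L => min (min (δG L) (δD L)) (min (δC L) (δC2 L)) with hδ₁
  set ν : ℕ → ℝ := fun L => δ₁ L / 2 with hν
  -- the window modulus: e := 1 + exp(4ν), V := (2(1+1/ν))³, A := C₁V, B := BV·V + BD·V, C := C₁V, D := 1 + C₂V, P := MT·e^{δ₁}·V, Q := MD·e^{δ₁}·V
  set Wm : ℕ → ℝ := fun L => (2 * (1 + Real.exp (4 * ν L)) * (C₁ L * (2 * (1 + 1 / ν L)) ^ 3) * (BV L * (2 * (1 + 1 / ν L)) ^ 3 + BD L * (2 * (1 + 1 / ν L)) ^ 3) + ((6 * (1 + Real.exp (4 * ν L)) + MD L * Real.exp (δ₁ L) * (2 * (1 + 1 / ν L)) ^ 3) * (C₁ L * (2 * (1 + 1 / ν L)) ^ 3) * ((1 + C₂ L * (2 * (1 + 1 / ν L)) ^ 3) + 2 * (1 + Real.exp (4 * ν L)) * (C₁ L * (2 * (1 + 1 / ν L)) ^ 3) * (BV L * (2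 * (1 + 1 / ν L)) ^ 3 + BD L * (2 * (1 + 1 / ν L)) ^ 3)) + MT L * Real.exp (δ₁ L) * (2 * (1 + 1 / ν L)) ^ 3 * (BV L * (2 * (1 + 1 / ν L)) ^ 3 + BD L * (2 * (1 + 1 / ν L)) ^ 3)) * (1 + C₂ L * (2 * (1 + 1 / ν L)) ^ 3)) with hWm
  set αP : ℕ → ℝ := fun L => min (min (min (min (αG L) (αD L)) (min (αC L) (αC2 L))) (min (min (αη L) (αc L)) (min (αT L) (αDv L)))) (1 / (2 * Wm L + 2)) with hαP
  have hδ₁0 : ∀ L, 1 < L → 0 < δ₁ L := fun L hL => by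
    have := hδG0 L hL; have := hδD0 L hL; have := hδC0 L; have := hδC20 L
    simp only [hδ₁]; exact lt_min (lt_min (by assumption) (by assumption)) (lt_min (by assumption) (by assumption))
  have hν0 : ∀ L, 1 < L → 0 < ν L := fun L hL => by have := hδ₁0 L hL; simp only [hν]; positivity
  have hWm0 : ∀ L, 1 < L → 0 ≤ Wm L := fun L hL => by
    have := hν0 L hL; have := hC₁0 L; have := hC₂0 L hL; have := hBV0 L hL; have := hBD0 L hL; have := hMT0 L hL; have := hMD0 L hL
    simp only [hWm]; positivity
  have hαP0 : ∀ L, 1 < L → 0 < αP L := fun L hL => by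
    have := hαG0 L hL; have := hαD0 L hL; have := (hαC L hL).1; have := (hαC2 L hL).1; have := hαη0 L hL; have := hαc0 L hL
    have := hαT0 L hL; have := hαDv0 L hL; have := hWm0 L hL
    simp only [hαP]
    exact lt_min (lt_min (lt_min (lt_min (by assumption) (by assumption)) (lt_min (by assumption) (by assumption)))
      (lt_min (lt_min (by assumption) (by assumption)) (lt_min (by assumption) (by assumption)))) (by positivity)
  have hPG : ∀ L, αP L ≤ αG L := fun L => by simp only [hαP]; exact (min_le_left _ _).trans ((min_le_left _ _).trans ((min_le_left _ _).trans (min_le_left _ _)))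
  have hPD : ∀ L, αP L ≤ αD L := fun L => by simp only [hαP]; exact (min_le_left _ _).trans ((min_le_left _ _).trans ((min_le_left _ _).trans (min_le_right _ _)))
  have hPC : ∀ L, αP L ≤ αC L := fun L => by simp only [hαP]; exact (min_le_left _ _).trans ((min_le_left _ _).trans ((min_le_right _ _).trans (min_le_left _ _)))
  have hPC2 : ∀ L, αP L ≤ αC2 L := fun L => by simp only [hαP]; exact (min_le_left _ _).trans ((min_le_left _ _).trans ((min_le_right _ _).trans (min_le_right _ _)))
  have hPη : ∀ L, αP L ≤ αη L := fun L => by simp only [hαP]; exact (min_le_left _ _).trans ((min_le_right _ _).trans ((min_le_left _ _).trans (min_le_left _ _)))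
  have hPc : ∀ L, αP L ≤ αc L := fun L => by simp only [hαP]; exact (min_le_left _ _).trans ((min_le_right _ _).trans ((min_le_left _ _).trans (min_le_right _ _)))
  have hPT : ∀ L, αP L ≤ αT L := fun L => by simp only [hαP]; exact (min_le_left _ _).trans ((min_le_right _ _).trans ((min_le_right _ _).trans (min_le_left _ _)))
  have hPDv : ∀ L, αP L ≤ αDv L := fun L => by simp only [hαP]; exact (min_le_left _ _).trans ((min_le_right _ _).trans ((min_le_right _ _).trans (min_le_right _ _)))
  have hPW : ∀ L, αP L ≤ 1 / (2 * Wm L + 2) := fun L => by simp only [hαP]; exact min_le_right _ _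
  have hP1 : ∀ L, 1 < L → αP L ≤ 1 := fun L hL => (hPT L).trans (hαT1 L hL)
  have h₁G : ∀ L, δ₁ L ≤ δG L := fun L => (min_le_left _ _).trans (min_le_left _ _)
  have h₁D : ∀ L, δ₁ L ≤ δD L := fun L => (min_le_left _ _).trans (min_le_right _ _)
  have h₁C : ∀ L, δ₁ L ≤ δC L := fun L => (min_le_right _ _).trans (min_le_left _ _)
  have h₁C2 : ∀ L, δ₁ L ≤ δC2 L := fun L => (min_le_right _ _).trans (min_le_right _ _)
  refine ⟨αP, fun L => 2 * (BV L * (2 * (1 + 1 / ν L)) ^ 3 + BD L * (2 * (1 + 1 / ν L)) ^ 3),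
    fun L => (2 * ((BV L * (2 * (1 + 1 / ν L)) ^ 3) + (BD L * (2 * (1 + 1 / ν L)) ^ 3)) * (2 * (1 + Real.exp (4 * ν L)) * (C₁ L * (2 * (1 + 1 / ν L)) ^ 3) * (BV L * (2 * (1 + 1 / ν L)) ^ 3) + (1 + (C₂ L * (2 * (1 + 1 / ν L)) ^ 3)) * ((6 * (1 + Real.exp (4 * ν L)) + MD L * Real.exp (δ₁ L) * (2 * (1 + 1 / ν L)) ^ 3) * (C₁ L * (2 * (1 + 1 / ν L)) ^ 3) * ((C₂ L * (2 * (1 + 1 / ν L)) ^ 3) + 2 * αP L * (1 + Real.exp (4 * ν L)) * (C₁ L * (2 * (1 + 1 / ν L)) ^ 3) * (BV L * (2 * (1 + 1 / ν L)) ^ 3)) + MT L * Real.exp (δ₁ L) * (2 * (1 + 1 / ν L)) ^ 3 * (BV L * (2 * (1 + 1 / ν L)) ^ 3)))),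
    ν, hαP0, fun L hL => ?_, fun L hL => ?_, fun L hL => ?_, hP1, fun L hL => ?_, fun L hL => ?_, hν0, ?_⟩
  · exact (mul_le_mul_of_nonneg_left (hPG L) (by positivity)).trans (hWG1 L hL)
  · exact (mul_le_mul_of_nonneg_left (hPG L) (by positivity)).trans (hWG2 L hL)
  · exact (mul_le_mul_of_nonneg_left (hPG L) (by positivity)).trans (hWG3 L hL)
  · have := hν0 L hL; have := hBV0 L hL; have := hBD0 L hL; positivity
  · have := hν0 L hL; have := hBV0 L hL; have := hBD0 L hL; have := hC₁0 L; have := hC₂0 L hL; have := hαP0 L hL; have := hMT0 L hL; have := hMD0 L hL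
    positivity
  intro L hL i U₀ ρ hreg hρ hlift a ha₀a ha₁a
  have hc₀L : 0 < c₀ L := (hc₀ L).out; have hcBL : 0 < cB L := (hcB L).out; have hL0 : (0 : ℝ) < L := by exact_mod_cast lt_trans zero_lt_one hL
  have hLL : (L : ℝ) = (i.1.1.L : ℝ) := by rw [i.2.1]
  have ha : 0 ≤ a := le_trans (by positivity) ha₀a
  have hνL := hν0 L hL; have hαL := hαP0 L hL
  have hregP : RegPr i.1.1 i.1.2.1 i.1.2.2 (αP L) U₀ := regPr_mono i.1.1 hρ hreg
  have hW13ρ : 13 * 10 ^ 14 * (i.1.1.L : ℝ) ^ 3 * ρ ≤ 1 := by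
    rw [← hLL]; exact (mul_le_mul_of_nonneg_left (hρ.trans (hPη L)) (by positivity)).trans (hWη3 L hL)
  -- the two positivity classes
  have hp₀ : PosOnto i.1.1 i.1.2.1 i.1.2.2 i.2.2.le (c₀ L) (cB L) a (DeltaEtaSlot i.1.1 i.1.2.1 i.1.2.2 (c₀ L)) U₀ :=
    posOnto_of_coercive i.2.2.le (cB L) i.2.2 hreg hW13ρ (hγη L hL) _ (hcoη L hL i U₀ ρ hreg (hρ.trans (hPη L)) hlift a ha₀a)
  have hp₁ : PosOnto i.1.1 i.1.2.1 i.1.2.2 i.2.2.le (c₀ L) (cB L) a (DeltaOneP i.1.1 i.1.2.1 i.1.2.2 i.2.2.le (c₀ L) (cB L) a (TJSlotP i.1.1 i.1.2.1 i.1.2.2 i.2.2.le (c₀ L) (cB L) a)) U₀ :=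
    (hco1 L hL i U₀ ρ hreg (hρ.trans (hPc L)) hlift a ha₀a ha₁a).2.1
  -- the five G-letters at the member, weakened to the common rate `δ₁ L`
  have hGb' := blockLetter_mono_rate (fun b : PBond (i.1.1.P i.1.2.2) 0 => iterBlockOf (i.1.2.2 - i.1.2.1) b.src)
    (fun bd : PBond (i.1.1.P i.1.2.2) 0 => iterBlockOf (i.1.2.2 - i.1.2.1) bd.src)
    (fun X bd => (toL2 i.1.1 i.1.2.2 (c₀ L)).symm (GT i.1.1 i.1.2.1 i.1.2.2 i.2.2.le (c₀ L) (cB L) a (DeltaEtaSlot i.1.1 i.1.2.1 i.1.2.2 (c₀ L)) U₀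
      (toL2 i.1.1 i.1.2.2 (c₀ L) X)) bd)
    (hBV0 L hL) (h₁G L) (hGb L hL i U₀ ρ hreg (hρ.trans (hPG L)) hlift a ha₀a ha₁a)
  have hDb' := blockLetter_mono_rate (fun b : PBond (i.1.1.P i.1.2.2) 0 => iterBlockOf (i.1.2.2 - i.1.2.1) b.src)
    (fun x : Site (i.1.1.P i.1.2.2) 0 => iterBlockOf (i.1.2.2 - i.1.2.1) x)
    (fun X x => (toL2S i.1.1 i.1.2.2 (c₀ L)).symm (DstarL2 i.1.1 i.1.2.1 i.1.2.2 (c₀ L) U₀ (GT i.1.1 i.1.2.1 i.1.2.2 i.2.2.le (c₀ L) (cB L) a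
      (DeltaEtaSlot i.1.1 i.1.2.1 i.1.2.2 (c₀ L)) U₀ (toL2 i.1.1 i.1.2.2 (c₀ L) X))) x)
    (hBD0 L hL) (h₁D L) (hDb L hL i U₀ ρ hreg (hρ.trans (hPD L)) hlift a ha₀a ha₁a)
  have hC13' := hC13 L hL i U₀ ρ hreg (hρ.trans (hPC L)) hlift a ha
  have hc1b' := blockLetter_mono_rate (fun y : Site (i.1.1.P i.1.2.2) 0 => iterBlockOf (i.1.2.2 - i.1.2.1) y)
    (fun y : Site (i.1.1.P i.1.2.2) 0 => iterBlockOf (i.1.2.2 - i.1.2.1) y)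
    (fun v y => (toL2S i.1.1 i.1.2.2 (c₀ L)).symm (GprimeP i.1.1 i.1.2.1 i.1.2.2 i.2.2.le (c₀ L) (cB L) a U₀
      (RS i.1.1 i.1.2.1 i.1.2.2 i.2.2.le (c₀ L) (cB L) U₀ (toL2S i.1.1 i.1.2.2 (c₀ L) v))) y)
    (hC₁0 L) (h₁C L) hC13'.1
  have hc3b' := blockLetter_mono_rate (fun y : Site (i.1.1.P i.1.2.2) 0 => iterBlockOf (i.1.2.2 - i.1.2.1) y)
    (fun y : Site (i.1.1.P i.1.2.2) 0 => iterBlockOf (i.1.2.2 - i.1.2.1) y)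
    (fun v y => (toL2S i.1.1 i.1.2.2 (c₀ L)).symm (RS i.1.1 i.1.2.1 i.1.2.2 i.2.2.le (c₀ L) (cB L) U₀
      (GprimeP i.1.1 i.1.2.1 i.1.2.2 i.2.2.le (c₀ L) (cB L) a U₀ (toL2S i.1.1 i.1.2.2 (c₀ L) v))) y)
    (hC₁0 L) (h₁C L) hC13'.2
  have hc2b' := blockLetter_mono_rate (fun y : Site (i.1.1.P i.1.2.2) 0 => iterBlockOf (i.1.2.2 - i.1.2.1) y)
    (fun b : PBond (i.1.1.P i.1.2.2) 0 => iterBlockOf (i.1.2.2 - i.1.2.1) b.src)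
    (fun v b => (toL2 i.1.1 i.1.2.2 (c₀ L)).symm (DL2 i.1.1 i.1.2.1 i.1.2.2 (c₀ L) U₀ (GprimeP i.1.1 i.1.2.1 i.1.2.2 i.2.2.le (c₀ L) (cB L) a U₀
      (RS i.1.1 i.1.2.1 i.1.2.2 i.2.2.le (c₀ L) (cB L) U₀ (toL2S i.1.1 i.1.2.2 (c₀ L) v)))) b)
    (hC₂0 L hL) (h₁C2 L) (hC2 L hL i U₀ ρ hreg (hρ.trans (hPC2 L)) hlift a ha)
  -- the two T-letters at the member, at the rate `δ₁ L`, at a radius `α'`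
  have hTb : ∀ α' : ℝ, 0 < α' → α' ≤ αP L → RegPr i.1.1 i.1.2.1 i.1.2.2 α' U₀ →
      ∀ (X : PBond (i.1.1.P i.1.2.2) 0 → Matrix (Fin 2) (Fin 2) ℂ) (z : Site (i.1.1.P i.1.2.2) (i.1.2.2 - i.1.2.1)),
        (∀ b, X b ≠ 0 → iterBlockOf (i.1.2.2 - i.1.2.1) b.src = z) → ∀ s : ℝ, 0 ≤ s → (∀ b, ‖X b‖ ≤ s) →
          ∀ bd : PBond (i.1.1.P i.1.2.2) 0, ‖(toL2 i.1.1 i.1.2.2 (c₀ L)).symm (TJSlotP i.1.1 i.1.2.1 i.1.2.2 i.2.2.le (c₀ L) (cB L) a U₀ (toL2 i.1.1 i.1.2.2 (c₀ L) X)) bd‖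
            ≤ s * (α' * MT L * Real.exp (δ₁ L)) * Real.exp (-(δ₁ L * (Site.tdist (P := i.1.1.P i.1.2.2) (iterBlockOf (i.1.2.2 - i.1.2.1) bd.src) z : ℝ))) :=
    fun α' hα'0 hα' hreg' => (hTv L hL i U₀ ρ hreg (hρ.trans (hPT L)) hlift a ha₀a ha₁a).2.2 α' hα'0 (hα'.trans (hPT L)) hreg' (δ₁ L) (hδ₁0 L hL).le
  have hTDb : ∀ α' : ℝ, 0 < α' → α' ≤ αP L → RegPr i.1.1 i.1.2.1 i.1.2.2 α' U₀ →
      ∀ (X : PBond (i.1.1.P i.1.2.2) 0 → Matrix (Fin 2) (Fin 2) ℂ) (z : Site (i.1.1.P i.1.2.2) (i.1.2.2 - i.1.2.1)),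
        (∀ b, X b ≠ 0 → iterBlockOf (i.1.2.2 - i.1.2.1) b.src = z) → ∀ s : ℝ, 0 ≤ s → (∀ b, ‖X b‖ ≤ s) →
          ∀ x : Site (i.1.1.P i.1.2.2) 0, ‖(toL2S i.1.1 i.1.2.2 (c₀ L)).symm (DstarL2 i.1.1 i.1.2.1 i.1.2.2 (c₀ L) U₀
              (TJSlotP i.1.1 i.1.2.1 i.1.2.2 i.2.2.le (c₀ L) (cB L) a U₀ (toL2 i.1.1 i.1.2.2 (c₀ L) X))) x‖
            ≤ s * (α' * MD L * Real.exp (δ₁ L)) * Real.exp (-(δ₁ L * (Site.tdist (P := i.1.1.P i.1.2.2) (iterBlockOf (i.1.2.2 - i.1.2.1) x) z : ℝ))) :=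
    fun α' hα'0 hα' hreg' => (hTd L hL i U₀ ρ hreg (hρ.trans (hPDv L)) hlift a ha₀a ha₁a).2 α' hα'0 (hα'.trans (hPDv L)) hreg' (δ₁ L) (hδ₁0 L hL).le
  have hWcap : αP L ≤ 1 / (2 * (2 * (1 + Real.exp (4 * ν L)) * (C₁ L * (2 * (1 + 1 / ν L)) ^ 3) * (BV L * (2 * (1 + 1 / ν L)) ^ 3 + BD L * (2 * (1 + 1 / ν L)) ^ 3) + ((6 * (1 + Real.exp (4 * ν L)) + MD L * Real.exp (δ₁ L) * (2 * (1 + 1 / ν L)) ^ 3) * (C₁ L * (2 * (1 + 1 / ν L)) ^ 3) * ((1 + C₂ L * (2 * (1 + 1 / ν L)) ^ 3) + 2 * (1 + Real.exp (4 * ν L)) * (C₁ L * (2 * (1 + 1 / ν L)) ^ 3) * (BV L * (2 * (1 + 1 / ν L)) ^ 3 + BD L * (2 * (1 + 1 / ν L)) ^ 3)) + MT L * Real.exp (δ₁ L) * (2 * (1 + 1 / ν L)) ^ 3 * (BV L * (2 * (1 + 1 / ν L)) ^ 3 + BD L * (2 * (1 + 1 / ν L)) ^ 3)) * (1 + C₂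 L * (2 * (1 + 1 / ν L)) ^ 3)) + 2) := by
    have h := hPW L; simp only [hWm] at h; exact h
  -- E2 at the cap (§2), E4 at every radius `α'` (§2)
  have h12 := hGblk_one_member i.1.1 i.2.2 (c₀ L) (cB L) a hνL (by simp only [hν]; linarith) U₀ hαL (hP1 L hL) hregP ha hp₀ hp₁
    (hBV0 L hL) (hBD0 L hL) (hC₁0 L) (hC₂0 L hL) (hMT0 L hL) (hMD0 L hL) hGb' hDb' hc1b' hc2b' hc3b' hTb hTDb hWcap
  refine ⟨h12.1, h12.2, fun α' hα'0 hα'1 hreg' => ?_⟩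
  exact hDelta_one_member i.1.1 i.2.2 (c₀ L) (cB L) a hνL (by simp only [hν]; linarith) U₀ (hP1 L hL) hα'0 hα'1 hreg' ha hp₀ hp₁
    (hBV0 L hL) (hBD0 L hL) (hC₁0 L) (hC₂0 L hL) (hMT0 L hL) (hMD0 L hL) hGb' hDb' hc1b' hc2b' hc3b' (hTb α' hα'0 hα'1 hreg') (hTDb α' hα'0 hα'1 hreg') hWcap

end Summit.QuantumFields.YangMills.Theorems.Prop7GreenOneBlockFamilyPackageAllMembers

end
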